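/-
Copyright (c) 2026 the pub-hodgecm-mathlib formalisation cell (harness21).  Prover seat hodgecm-mathlib-K2E4-p10 (g10), Track B «K2-LIT»,
#184♮ = hLiu418 = `stmt-HodgeConjecture-24832`; socket #41, KIND 1 — (K1a-dec-L4) THE TRANSPORTED-SCALAR BOUND LETTER OF ★ p863488 `hdec_of_factorBounds` (its (L4) binder)
from ★ p863157 + local boundedness of the holomorphic scalar + ONE count letter (offer 2026-09-05T01:04:23Z to LEAD F0P6-plan (g15) ∕ K1a desk K2E5-p16 (g8), silence = GO).
THEOREMS ONLY (no `def`, no `instance`, no notation, no named-fact hypothesis, no `sorry`).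
-/
import Summits.HodgeConjecture.HodgeConjecture.Theorems.K2LiuKindOneSingularDecayOfLetters   -- ★ p863488 (this seat): the consumer `hdec_of_factorBounds` (binder (L4) `hGb`); ⊇ ★ p863157 `norm_transportedG_le`
import Mathlib.Analysis.Normed.Group.Bounded
import HarnessLib

/-!
# Crux `HLiu418`, socket #41, KIND 1 — (K1a-dec-L4) `K2LiuKindOneSingularScalarBound`: THE BOUND `‖(∏_{v∈Pm S h} c¹_v(s)⁻¹)·G s‖ ≤ C·H(h)^a·(1 + τa S)^N` NEAR EVERY `z`

Cell `hodgecm-mathlib`, crux item hLiu418 = `stmt-HodgeConjecture-24832` (helper lane `--supports … --as helper`, count-neutral), route of record `HCCMUnconditional`;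
squad K2 ∕ K2Liu, road `K2_Liu`, socket #41, KIND 1 a♮; line lead K2E5-p16 (g8).  ★ p863488 `K2LiuKindOneSingularDecayOfLetters.hdec_of_factorBounds` (this seat) takes five
per-factor letters; its (L4) letter is the bound, locally near every `z ∈ {0 < re}`, on the TRANSPORTED pole-cleared K1 scalar `(∏_{v∈Pm S h} c¹_v(s)⁻¹)·G s` of ★ p863404 §2's
explicit rank-one expression (`c¹_v(s)⁻¹ = (1 − q_v^{−2s}) ∕ ((1 − q_v^{−(2s+1)})(1 − ε_v q_v^{−(2s+2)}))`, ★ p863157).  THIS FILE pays (L4) from: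
* ★ p863157 `K2LiuKindOneSingularScalarChangeOfSet.norm_transportedG_le`: `‖(∏_{v∈P} c¹_v(s)⁻¹)·G s‖ ≤ (16∕3)^{#P}·‖G s‖` on `{0 < re}` (`ε_{L∕L⁺}` unitary — finite order);
* the LOCAL BOUNDEDNESS of the continued scalar: `G` holomorphic on `{0 < re}` (`hG`, ★ p862613's letter) is continuous on the compact ball `closedBall z (re z ∕ 2) ⊂ {0 < re}`, hence
  bounded there (Mathlib `IsCompact.exists_bound_of_continuousOn`) — no letter needed;
* ONE COUNT LETTER BY VALUE: `(16∕3)^{#(Pm S h)} ≤ Cp·H(h)^{ap}·(1 + τa S)^{Np}` on rank-one `S` (the number of finite places moved into the exceptional set — the prime divisors of the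
  corner index `σ♭(S)` off `T S h`, (K1a-T) ★ p863805's `Pm` — against the size of `S`; owed by the `Pm` producer's arithmetic, stated here hypothesis-first).
OUTPUT **`hGb_of_countLetter`** = ★ p863488's (L4) binder BYTES: `∀ z, 0 < re z → ∃ (N₃ : ℕ) (C a r : ℝ), 0 ≤ C ∧ 0 ≤ a ∧ 0 < r ∧ ∀ S s, dist s z < r → ∀ h, ↑S ≠ 0 → det ↑S = 0 →
‖(∏_{v∈Pm S h} c¹_v(s)⁻¹)·G s‖ ≤ C·H(h)^a·(1 + τa S)^{N₃}` with `N₃ := Np`, `a := ap`, `C := Cp·sup_{closedBall z (re z∕2)} ‖G‖`, `r := re z ∕ 2`.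
[Tan1999, §3], [KudlaSweet1997, §1], [MoeglinWaldspurger1995, IV.1.9].
HONEST LABEL.  Elementary bookkeeping, count-neutral, hypothesis-first on the count letter; it closes no socket: `HC_CM` is proved only modulo the 7 printed citations (2 remaining
named inputs: hLiu418 = `stmt-HodgeConjecture-24832`, h413 = `stmt-HodgeConjecture-24833`) until rung 0 closes.

## References
* [Tan1999] V. Tan, Canad. J. Math. 51 (1999): §3 (the unramified scalars).   * [KudlaSweet1997] S. Kudla, W. J. Sweet, Israel J. Math. 98 (1997): §1.
* [MoeglinWaldspurger1995] C. Mœglin, J.-L. Waldspurger (1995): IV.1.9.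
-/

set_option autoImplicit false
-- the mandated namespace repeats the single-problem summit's segment (`HodgeConjecture.HodgeConjecture`)
set_option linter.dupNamespace false

noncomputable section

open scoped Matrix ENNReal NNReal Topology ComplexConjugate
open NumberField IsDedekindDomain MeasureTheory MeasureTheory.Measure Filter Set Function Metric
open Literature.NumberTheory.Automorphic Literature.NumberTheory.Automorphic.UnitaryGroup Literature.NumberTheory.GaloisRepresentations
open Literature.NumberTheory.LFunctions
open Literature.NumberTheory.GelbartRogawski1991 Literature.NumberTheory.GelbartRogawski1991.GRConstruction
open Literature.NumberTheory.K2Lit.SiegelDoubled Literature.MeasureTheory.Group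
open Literature.NumberTheory.Automorphic.IdeleClassGroup

namespace Summit.HodgeConjecture.HodgeConjecture.Cruxes.HLiu418.K2LiuKindOneSingularScalarBound

open K2LiuSiegelUnipotentFourierDefs K2LiuSiegelUnipotentCharacters K2LiuUnipotentCoveringWeight K2LiuSiegelFourierCoeffDelta
open K2LiuKindOneSingularScalarChangeOfSet (norm_transportedG_le)

/-- **a closed ball of radius `re z ∕ 2` about a point of the right half-plane stays in the right half-plane**: `dist s z ≤ re z ∕ 2 ⇒ 0 < re s`
(`|re (s − z)| ≤ ‖s − z‖`). [folklore] -/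
theorem re_pos_of_dist_le_half {z s : ℂ} (hz : 0 < z.re) (hs : dist s z ≤ z.re / 2) : 0 < s.re := by
  have h := Complex.abs_re_le_norm (s - z)
  rw [Complex.sub_re, ← dist_eq_norm] at h
  have h' := (abs_le.1 (h.trans hs)).1
  linarith

open Classical in
/-- **(K1a-dec-L4) THE TRANSPORTED-SCALAR BOUND FROM ONE COUNT LETTER.**  For the pole-cleared K1 scalar `G` (holomorphic on `{0 < re}`) and the moving part `Pm S h` of the
exceptional set: if `(16∕3)^{#(Pm S h)} ≤ Cp·H(h)^{ap}·(1 + τa S)^{Np}` on rank-one `S` (count letter, by value), then near every `z ∈ {0 < re}` (radius `re z ∕ 2`)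
`‖(∏_{v∈Pm S h} c¹_v(s)⁻¹)·G s‖ ≤ (Cp·C_G(z))·H(h)^{ap}·(1 + τa S)^{Np}` with `C_G(z) = sup ‖G‖` on the closed ball (★ `norm_transportedG_le` + compactness) — ★ p863488's (L4) binder.
[cite: Tan1999, §3] [cite: KudlaSweet1997, §1] [cite: MoeglinWaldspurger1995, IV.1.9] -/
theorem hGb_of_countLetter
    (L : Type) [Field L] [NumberField L] [IsCMField L] {n : ℕ} (e : Fin 2 × Fin 1 ≃ Fin n)
    (dV : Fin 2 → L) (hdV : ∀ i, IsCMField.complexConj L (dV i) = dV i)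
    (dW : Fin 1 → L) (hdW : ∀ i, IsCMField.complexConj L (dW i) = dW i)
    -- the pole-cleared K1 scalar of record and the moving part of the exceptional set (★ p863404 §2 (i)–(ii))
    (G : ℂ → ℂ) (hG : DifferentiableOn ℂ G {s : ℂ | 0 < s.re})
    (Pm : skewMatrices ((IsCMField.complexConj L : L ≃ₐ[Fp L] L) : L →+* L) ((gramR L e dV hdV dW hdW).map (algebraMap (Fp L) L)) → HA L e dV hdV dW hdW → Finset (HeightOneSpectrum (𝓞 ↥(maximalRealSubfield L))))
    (τa : skewMatrices ((IsCMField.complexConj L : L ≃ₐ[Fp L] L) : L →+* L) ((gramR L e dV hdV dW hdW).map (algebraMap (Fp L) L)) → ℝ)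
    -- THE COUNT LETTER, by value: the number of moved places against the height and the size
    (Np : ℕ) {Cp ap : ℝ} (hCp : 0 ≤ Cp) (hap : 0 ≤ ap)
    (hPm : ∀ (S : skewMatrices ((IsCMField.complexConj L : L ≃ₐ[Fp L] L) : L →+* L) ((gramR L e dV hdV dW hdW).map (algebraMap (Fp L) L))) (h : HA L e dV hdV dW hdW), (S : Matrix (Fin n) (Fin n) L) ≠ 0 → (S : Matrix (Fin n) (Fin n) L).det = 0 →
      (16 / 3 : ℝ) ^ (Pm S h).card ≤ Cp * adelicHeightGL (n + n) L (h : GL (Fin (n + n)) (AdeleRing (𝓞 L) L)) ^ ap * (1 + τa S) ^ Np) :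
    ∀ z : ℂ, 0 < z.re → ∃ (N₃ : ℕ) (C a r : ℝ), 0 ≤ C ∧ 0 ≤ a ∧ 0 < r ∧
      ∀ (S : skewMatrices ((IsCMField.complexConj L : L ≃ₐ[Fp L] L) : L →+* L) ((gramR L e dV hdV dW hdW).map (algebraMap (Fp L) L))) (s : ℂ), dist s z < r → ∀ h : HA L e dV hdV dW hdW, (S : Matrix (Fin n) (Fin n) L) ≠ 0 → (S : Matrix (Fin n) (Fin n) L).det = 0 →
      ‖((∏ v ∈ Pm S h, ((1 - (v.residueCard : ℂ) ^ (-(2 * s))) / ((1 - (v.residueCard : ℂ) ^ (-(2 * s + 1))) * (1 - (quadraticHeckeCharCM L).valueAtUniformizer v * (v.residueCard : ℂ) ^ (-(2 * s + 2)))))) * G s)‖ ≤ C * adelicHeightGL (n + n) L (h : GL (Fin (n + n)) (AdeleRing (𝓞 L) L)) ^ a * (1 + τa S) ^ N₃ := by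
  intro z hz
  -- `ε_{L∕L⁺}` is unitary (finite order): the hypothesis of ★ `norm_transportedG_le`
  have hε : (quadraticHeckeCharCM L).IsUnitary := (Literature.RepresentationTheory.HarrisKudlaSweet1996.isFiniteOrder_quadraticHeckeCharCM (L := L)).isUnitary
  -- the continued scalar is bounded on the compact ball `closedBall z (re z ∕ 2) ⊂ {0 < re}`
  have hball : closedBall z (z.re / 2) ⊆ {s : ℂ | 0 < s.re} := fun s hs => re_pos_of_dist_le_half hz (mem_closedBall.1 hs)
  obtain ⟨CG, hCG⟩ := (isCompact_closedBall z (z.re / 2)).exists_bound_of_continuousOn (hG.continuousOn.mono hball)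
  have hCG0 : 0 ≤ CG := (norm_nonneg _).trans (hCG z (mem_closedBall_self (by positivity)))
  refine ⟨Np, Cp * CG, ap, z.re / 2, mul_nonneg hCp hCG0, hap, by positivity, fun S s hs h hS0 hSd => ?_⟩
  have hs' : s ∈ closedBall z (z.re / 2) := mem_closedBall.2 hs.le
  have hs0 : 0 < s.re := re_pos_of_dist_le_half hz hs.le
  calc ‖((∏ v ∈ Pm S h, ((1 - (v.residueCard : ℂ) ^ (-(2 * s))) / ((1 - (v.residueCard : ℂ) ^ (-(2 * s + 1))) * (1 - (quadraticHeckeCharCM L).valueAtUniformizer v * (v.residueCard : ℂ) ^ (-(2 * s + 2)))))) * G s)‖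
      ≤ (16 / 3 : ℝ) ^ (Pm S h).card * ‖G s‖ := norm_transportedG_le hε (Pm S h) G hs0
    _ ≤ (Cp * adelicHeightGL (n + n) L (h : GL (Fin (n + n)) (AdeleRing (𝓞 L) L)) ^ ap * (1 + τa S) ^ Np) * CG :=
        mul_le_mul (hPm S h hS0 hSd) (hCG s hs') (norm_nonneg _) ((pow_nonneg (by norm_num) _).trans (hPm S h hS0 hSd))
    _ = Cp * CG * adelicHeightGL (n + n) L (h : GL (Fin (n + n)) (AdeleRing (𝓞 L) L)) ^ ap * (1 + τa S) ^ Np := by ring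

end Summit.HodgeConjecture.HodgeConjecture.Cruxes.HLiu418.K2LiuKindOneSingularScalarBound

end
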